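import Summits.ResolutionOfSingularities.ResolutionOfSingularities.Theorems.LossExitCone
import HarnessLib

/-!
# LossExitCone2 — decomp-res node «LossExitCone» (lens-3 g27 «LossLayer» rev 3 addendum; critic row 220 + addendum;
LANDING ASK INBOX :1644), tree file 2/5 of the node

Content VERBATIM from the decomp-res lens-3 g27 «LossLayer» rev 3 addendum files
`HOME/decomp-res-lens-3/g27/land/LossExitCone{,2,3}.lean` (5d9cd97a / b64a38c9 / 60e238a8; RE-PIN STATUS 13:02:33Z;
critic row 220 + addendum); tree names LossExitCone/2 = lens (4), LossExitCone3 = lens (5), LossExitCone4/5 = lens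
(6) — provenance and the lens header in full in `LossExitCone`. `--kind proof --supports
stmt-ResolutionOfSingularities-27367`; no aside change, no item.

## This file

Continuation 2/2 of `LossExitCone` (same namespace / sections of the node, cut at the tree's 400-line cap; section
variables / opens replayed): scopes `Run` — carries `degree_le_of_mem_support_resLayer`, `bUnit_eq_one`,
`resForm_eq_resLayer`, `coeff_resForm_top`, `apply_eq_of_untranslated_plateau`, `resForm_succ_eq`, `resForm_run_eq`.

[WRITER NOTE (decomp-res writer g14): file split only (tree files ≤ 400 lines) — cut at the node's section
boundaries where possible (§1 | §2; §3–§3⁺ whole; §4 by the cap between two declarations with `section Switch` and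
its `variable` line replayed); file-level `open` lines replayed in every part; every declaration, docstring and `/-!
## § -/` comment exactly as in the lens files.]

(Sources: Hauser2010 §F; HauserPerlega2019 §2; CossartJannsenSaito2020 Ch. 8; Moh1987; Perlega2022.)
-/

open MvPolynomial Finset
open Literature.AlgebraicGeometry.Resolution
open Literature.AlgebraicGeometry.Resolution.Hauser2010
open Literature.AlgebraicGeometry.Resolution.PointBlowup
open Literature.AlgebraicGeometry.Resolution.WeightedBlowup
open Summit.ResolutionOfSingularities.ResolutionOfSingularities.Theorems.TightDefectClasses
open Summit.ResolutionOfSingularities.ResolutionOfSingularities.Theorems.TightDefectStrongWalks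
open Summit.ResolutionOfSingularities.ResolutionOfSingularities.Theorems.ItineraryCutClasses
open Summit.ResolutionOfSingularities.ResolutionOfSingularities.Theorems.BoundaryLedger
open Summit.ResolutionOfSingularities.ResolutionOfSingularities.Theorems.ProximityCut
open Summit.ResolutionOfSingularities.ResolutionOfSingularities.Theorems.ConeCut
open Summit.ResolutionOfSingularities.ResolutionOfSingularities.Theorems.WallCutRun

namespace Summit.ResolutionOfSingularities.ResolutionOfSingularities.Theorems.LossExitCone

section Run

variable {K : Type} [Field K] [DecidableEq K] {q : ℕ} {s₀ : State (Fin 3) K}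

/-! ## §2 The residual form along untranslated moves -/

-- [WRITER NOTE (decomp-res writer g14): the node's unused bookkeeping lemma `coeff_resLayer_eq_zero_of_apply_ne_zero`
-- (`E j ≠ 0 → coeff E (resLayer j s o) = 0`) stood here; it is STATEMENT-IDENTICAL to the landed
-- `TightCut.coeff_resLayer_eq_zero_of_ne` (Theorems/TightCutCharts.lean, in this file's import closure; gate dedup.landed, p823862) —
-- deleted; nothing in the node cites it, so no use had to be requalified.]

omit [DecidableEq K] in
/-- Every monomial of `resLayer j s o` has degree `≤ o − |r|` (when `r` divides every monomial of `F`). [folklore] -/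
theorem degree_le_of_mem_support_resLayer (j : Fin 3) (s : State (Fin 3) K) (hr : ∀ d ∈ s.F.support, s.r ≤ d)
    (o : ℕ) {A : Fin 3 →₀ ℕ} (hA : A ∈ (resLayer j s o).support) : A.degree + s.r.degree ≤ o := by
  classical
  rw [mem_support_iff] at hA
  unfold resLayer at hA
  rw [coeff_sum] at hA
  obtain ⟨d, hd, hdA⟩ := Finset.exists_ne_zero_of_sum_ne_zero hA
  rw [Finset.mem_filter] at hd
  rw [coeff_monomial] at hdA
  by_cases h : (d - s.r).update j 0 = A
  · have hle := hr d hd.1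
    have h1 := congrArg Finsupp.degree (tsub_add_cancel_of_le hle)
    rw [map_add] at h1
    have h2 := degree_update_zero_add (d - s.r) j
    rw [h] at h2
    have h3 := hd.2
    omega
  · exact absurd (if_neg h) hdA

/-- The unit `bUnit` of an untranslated move is `1`. [folklore] -/
theorem bUnit_eq_one (W : ForcedWalk q s₀) (w : ℕ) (hb : W.b w = 0) : bUnit W w = 1 := by
  classical
  unfold bUnit
  have h0 : (W.st w).r.filter (fun l => W.b w l ≠ 0) = 0 := by
    ext l
    rw [Finsupp.filter_apply, if_neg (by rw [hb]; simp), Finsupp.zero_apply]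
  rw [h0, hb, PointBlowup.translate_zero, ← C_apply, C_1, coeff_zero_one]

/-- The residual form of an untranslated move is the dehomogenised layer itself. [folklore] -/
theorem resForm_eq_resLayer (W : ForcedWalk q s₀) (w o : ℕ) (hb : W.b w = 0) :
    resForm W w o = resLayer (W.j w) (W.st w) o := by
  unfold resForm
  rw [hb, PointBlowup.translate_zero]

/-- The top-degree coefficients of the residual form are coefficients of `F`: on a stage of shade `n` and order `o`,
for `|E| = n` one has `coeff_E (resForm W w o) = coeff_{r + E} F_w` (any translation; `E` at the chart letter `=
0`). [folklore] -/
theorem coeff_resForm_top (hroot : IsRoot q s₀) (W : ForcedWalk q s₀) (w : ℕ) {o n : ℕ}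
    (ho : ordZero (W.st w).F = (o : ℕ∞)) (hn : (W.st w).shade = (n : ℕ∞)) {E : Fin 3 →₀ ℕ} (hE : E.degree = n)
    (hEj : E (W.j w) = 0) : coeff E (resForm W w o) = coeff ((W.st w).r + E) (W.st w).F := by
  classical
  obtain ⟨n', hn', hon⟩ := order_eq_shade_add_degree hroot W w ho
  have hnn : n' = n := by
    have h := hn
    rw [hn'] at h
    exact_mod_cast h
  subst hnn
  unfold resForm
  rw [coeff_translate_of_degree (W.b w) _ (n := n') ?_ hE]
  · rw [← update_zero_of_apply_eq_zero hEj]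
    rw [update_zero_of_apply_eq_zero hEj]
    have := coeff_resLayer (W.j w) (W.st w) (walk_r hroot W w) o E (by rw [hE, hon])
    rwa [update_zero_of_apply_eq_zero hEj] at this
  · intro A hA
    have := degree_le_of_mem_support_resLayer (W.j w) (W.st w) (walk_r hroot W w) o hA
    omega

/-- **UNTRANSLATED PLATEAU MOVES SEE A CONE OFF THE CHART AXIS (PROVED):** at an untranslated plateau move `w` in the chart
`i = W.j w` (order `o > q`), every monomial of the initial form of `F_w` has `i`-degree exactly `r_w(i)`: the initial form
is `u_i^{r_i}` times a form in the two other letters (the apex of the tangent cone lies on the `u_i`-axis). [folklore] -/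
theorem apply_eq_of_untranslated_plateau (hroot : IsRoot q s₀) (W : ForcedWalk q s₀) (w : ℕ) {o : ℕ}
    (ho : ordZero (W.st w).F = (o : ℕ∞)) (hqo : q < o) (hplat : (W.st (w + 1)).shade = (W.st w).shade)
    (hb : W.b w = 0) {d : Fin 3 →₀ ℕ} (hd : d ∈ (W.st w).F.support) (hdeg : d.degree = o) :
    d (W.j w) = (W.st w).r (W.j w) := by
  classical
  obtain ⟨n, hn, hon⟩ := order_eq_shade_add_degree hroot W w ho
  have hcone := (cone_of_plateau hroot W w ho hqo hplat hn).1
  rw [resForm_eq_resLayer W w o hb] at hcone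
  have hle := walk_r hroot W w d hd
  have hm : (d - (W.st w).r).degree + (W.st w).r.degree = o := by
    have := congrArg Finsupp.degree (tsub_add_cancel_of_le hle)
    rw [map_add] at this
    omega
  have hc := coeff_resLayer (W.j w) (W.st w) (walk_r hroot W w) o (d - (W.st w).r) hm
  rw [add_tsub_cancel_of_le hle] at hc
  have hne : coeff ((d - (W.st w).r).update (W.j w) 0) (resLayer (W.j w) (W.st w) o) ≠ 0 := by
    rw [hc]
    exact mem_support_iff.mp hd
  have hdeg' : ((d - (W.st w).r).update (W.j w) 0).degree = n := by
    by_contra h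
    exact hne (hcone.coeff_eq_zero h)
  have h2 := degree_update_zero_add (d - (W.st w).r) (W.j w)
  have h3 : (d - (W.st w).r) (W.j w) = 0 := by omega
  rw [Finsupp.tsub_apply] at h3
  have h4 := hle (W.j w)
  omega

/-- **THE RESIDUAL FORM IS REPRODUCED ALONG A SAME-CHART PLATEAU MOVE (PROVED):** if the moves `w`, `w+1` are in the
same chart (ANY translations) and the stages `w`, `w+1`, `w+2` have the same shade (orders `> q`), then
`resForm W (w+1) o' = C (bUnit W w) · resForm W w o` — the cone law makes the residual form of the second move homogeneous,
hence equal to its top-degree part, which is the restriction of the initial form of `F_{w+1}` to the new wall, which is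
`bUnit W w` times the residual form of the first move (`ConeCut.restriction_of_plateau`).  Along an untranslated straight run
the residual form is therefore constant (`bUnit = 1`, `bUnit_eq_one`, `resForm_run_eq`). [new] [folklore] -/
theorem resForm_succ_eq (hroot : IsRoot q s₀) (W : ForcedWalk q s₀) (w : ℕ) {o o' : ℕ}
    (ho : ordZero (W.st w).F = (o : ℕ∞)) (ho' : ordZero (W.st (w + 1)).F = (o' : ℕ∞)) (hqo : q < o) (hqo' : q < o')
    (hplat : (W.st (w + 1)).shade = (W.st w).shade) (hplat' : (W.st (w + 2)).shade = (W.st (w + 1)).shade)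
    (hj : W.j (w + 1) = W.j w) :
    resForm W (w + 1) o' = C (bUnit W w) * resForm W w o := by
  classical
  obtain ⟨n, hn, hon⟩ := order_eq_shade_add_degree hroot W w ho
  have hn1 : (W.st (w + 1)).shade = (n : ℕ∞) := by rw [hplat, hn]
  have hcone := (cone_of_plateau hroot W w ho hqo hplat hn).1
  have hcone' := (cone_of_plateau hroot W (w + 1) ho' hqo' hplat' hn1).1
  ext E
  rw [coeff_C_mul]
  by_cases hEi : E (W.j w) = 0
  · by_cases hdeg : E.degree = n
    · rw [coeff_resForm_top hroot W (w + 1) ho' hn1 hdeg (by rw [hj]; exact hEi),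
        restriction_of_plateau hroot W w ho hqo hplat hn E hEi hdeg]
    · rw [hcone.coeff_eq_zero hdeg, hcone'.coeff_eq_zero hdeg, mul_zero]
  · rw [coeff_resForm_eq_zero W w o hEi, coeff_resForm_eq_zero W (w + 1) o' (by rw [hj]; exact hEi), mul_zero]

/-- Iterate of `resForm_succ_eq` along a straight run: if the moves `w, w+1, …, w+n+1` are in the same chart, the INNER
moves `w+1, …, w+n` are untranslated (the first and the last may be translated), and the shade is constant on the stages
`w, …, w+n+2` (orders `> q`), then `resForm W (w+n+1) o_{n+1} = C (bUnit W w) · resForm W w o_0`. [new] [folklore] -/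
theorem resForm_run_eq (hroot : IsRoot q s₀) (W : ForcedWalk q s₀) (w n : ℕ) (o : ℕ → ℕ)
    (ho : ∀ a, a ≤ n + 1 → ordZero (W.st (w + a)).F = ((o a : ℕ) : ℕ∞)) (hqo : ∀ a, a ≤ n + 1 → q < o a)
    (hplat : ∀ a, a ≤ n + 1 → (W.st (w + a + 1)).shade = (W.st (w + a)).shade)
    (hj : ∀ a, a ≤ n → W.j (w + a + 1) = W.j w) (hb : ∀ a, a < n → W.b (w + a + 1) = 0) :
    resForm W (w + n + 1) (o (n + 1)) = C (bUnit W w) * resForm W w (o 0) := by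
  induction n with
  | zero =>
    exact resForm_succ_eq hroot W w (o := o 0) (o' := o 1) (ho 0 (by omega)) (ho 1 (by omega)) (hqo 0 (by omega))
      (hqo 1 (by omega)) (hplat 0 (by omega)) (hplat 1 (by omega)) (hj 0 le_rfl)
  | succ n ih =>
    have ih' := ih (fun a ha => ho a (by omega)) (fun a ha => hqo a (by omega)) (fun a ha => hplat a (by omega))
      (fun a ha => hj a (by omega)) (fun a ha => hb a (by omega))
    have hjn : W.j (w + n + 1 + 1) = W.j (w + n + 1) := by
      rw [show w + n + 1 + 1 = w + (n + 1) + 1 by ring, hj (n + 1) le_rfl, ← hj n (by omega)]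
    have hstep := resForm_succ_eq hroot W (w + n + 1) (o := o (n + 1)) (o' := o (n + 2)) (ho (n + 1) (by omega))
      (ho (n + 2) (by omega)) (hqo _ (by omega)) (hqo _ (by omega)) (hplat (n + 1) (by omega)) (hplat (n + 2) (by omega))
      hjn
    rw [show w + (n + 1) + 1 = w + n + 1 + 1 by ring, hstep, ih', ← mul_assoc, ← C_mul,
      bUnit_eq_one W (w + n + 1) (hb n (by omega)), one_mul]

end Run

end Summit.ResolutionOfSingularities.ResolutionOfSingularities.Theorems.LossExitCone
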